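import Summits.QuantumFields.YangMills.Theorems.BalabanUVNodesN07DataDownTheRadialTower
import Literature.MathematicalPhysics.QuantumFieldTheory.Balaban1983to89.B8Eq131Cubes
import HarnessLib

/-!
# DAG node N07 [B11] — (145)∕(151) DOWN THE □̃-TOWER ONTO THE CANONICAL BOXES: [6] p. 98's cube `□̃` («a distance of its boundary to `□` is equal to `2R₁M₁`») and its
# blow-downs `□̃^{(j)}` CARRY the canonical level boxes `[□_j^{(j)} − 𝟙, □_j^{(j)} + 𝟙]` of the S6 head's `HCHART` binder (dag-n07-w4 p633893, p627154's four `lo∕hi` equations), so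
# this base's capstones (FILE 9 `dist1_iter_le_down_the_radialRep_blowDown` ∕ `…_radialTower_blowDown`, FILE 6 `dist1_iter_rep_le_down_the_tower_blowDown`) — keyed on EXACT blow-down
# towers — deliver the head's `v`-clause `dist1 (M^{j'} U″ c) ≤ v_{j'}` on the CANONICAL boxes by one restriction

Cell `pub-ymgap` (HUMAN RULINGS D-0062 ∕ D-0088 ∕ D-0149), width seat `pub-ymgap-dag-n07-w6` (second wave), harness re-seat g2, 2026-08-28; CLAIM-1 ∕ INTENT-1 (cell bus): the (t2) successor
trigger of `HANDOFF-dag-n07-w6.md` §g0″ («canonical-box instances of FILES 6∕9»), fired by the landed HCHART shape.  `--kind proof --supports stmt-QuantumFields-27364 --as helper` (K1⁹ per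
dag-lead KEY MAP v2; count-neutral).  THEOREMS ONLY.

THE PRINT.  [6] = [Balaban1985RegularSpaces] p. 98: «Let us take a cube `□` which is a sum of cubes of the cover … cubes `□_k, □_{k−1}, …, □₀` such that `□_j ⊃ □_{j+1}` and a distance between
boundaries of these cubes is equal to `R₁M₁Lʲη` … `< (1 − L⁻¹)⁻¹R₁M₁ ≤ 2R₁M₁` … a cube which we denote by `□̃`. A distance of its boundary to `□` is equal to `2R₁M₁`», (1.131)–(1.133) p. 99;
[B11] = [Balaban1985Variational] (144) p. 300, (145)–(147), (151) p. 301 («`U′_k ∈ Ax_k(□̃(k), 1)`», «on `□̃`»).  Tree currency: `B8Eq131Cubes` (`sqLo∕sqHi` = corners of `□_j^{(j)}`,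
`tLo∕tHi` = corners of `□̃^{(k)}`, margins `ρ·gs L (k−j)`, `sq_le_tilde`), `B8Ineq130` (`tlo∕thi` = the blow-down tower of a top box).

WHAT THIS FILE DOES (elementary `ℤ^d` box arithmetic + by-name restriction; NOTHING of [B11]∕[6]∕[B5] analysis asserted).
* §1 (pure `ℤ^d`): the □̃-tower `j ↦ [tlo L (tLo a ρ) (k−j), thi L (tHi a M ρ) (k−j)]` IS an exact blow-down tower (`tildeTower_lo_step`, `tildeTower_hi_step`) of top width `M + 4ρ − 1`
  (`tHi_le_tLo_add`); ★ `levelBox_bounds` ∕ `levelBox_subset_tildeTower`: `[sqLo_j − 𝟙, sqHi_j + 𝟙] ⊆ □̃^{(j)}` for EVERY `j` (`2 ≤ L`, `1 ≤ ρ`; the margin inequality `ρ·gs L n + 1 ≤ 2ρLⁿ`,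
  `margin_succ_le_tilde`), ★ `levelBox_zero_subset_tildeTower` (the level-0 box = blow-down of the level-1 box ⊆ `□̃`), ★★ `castSite_levelBoxes_subset_tildeTower` (all levels at once under the
  torus projection, from p627154's four equations VERBATIM), `exists_levelBoxes` (the four equations are inhabited).
* §2 ★★★ `dist1_iter_le_down_the_radialTower_levelBoxes` ∕ ★★★★ `dist1_iter_le_down_the_radialRep_levelBoxes` ∕ ★★ `dist1_iter_rep_le_down_the_tower_levelBoxes`: FILE 9 §2's two capstones and
  FILE 6's capstone RUN ON THE □̃-TOWER (top box `□̃^{(k)} = [tLo a ρ, tHi a M ρ]`, non-wrapping `M + 4ρ < sitesPerDir k`, per-level (7)-letters of the representative's averages on the □̃-tower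
  boxes, top letter `v_k` resp. `(d−1)(M+4ρ−1)δ` from module 40, ladder as in FILES 6∕9) and RESTRICTED to the canonical boxes: conclusion = the `v`-clause shape of `HCHART`
  (`∀ j' ≤ k, ∀ c, c.src, c.tgt ∈ castSite '' [lo j', hi j'] → dist1 (M^{j'} U″ c) ≤ v j'`) with the four `lo∕hi` equations as binders.
* §3 `ladder_of_sum` + ★★★ `dist1_iter_le_down_the_radialRep_levelBoxes_explicit`: the ladder SUPPLIED by the explicit affine choice `v_j := (d−1)(M+4ρ−1)δ + C′·Σ_{i∈[j,k)} a_i`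
  (`C′ := 7((d+2)L)²∕4 + ((d+1)(L−1)+1)(d(L−1)+1)(d−1)(L−1)`) — the head's «letters affine per level, uniform in the datum» shape (dag-n07-w4 g4 CLAIM-8): only the (7)-letters `a_i` and
  the top letter `δ` remain displayed.

HONEST FRAMING (binding).  Count-neutral helper; by-name composition of LANDED theorems (this base FILES 4∕6∕9, dag-n07-e module 40, dag-n07-w5 p630918) with elementary box arithmetic; the
per-level (7)-smallness of the representative's averages on the □̃-tower, the top data letter, non-wrapping and the ladder evaluation are HYPOTHESES ∕ the consumer's; `HCHART` is NOT
discharged here; nothing of [B11]∕[6]∕[B5] analysis asserted; `stub_prop8StepCoP13` ∕ K0⁷ ∕ K1⁹ NOT closed; N07 NOT discharged; the chair's tally of record is the only count; **no summit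
statement is proved by this seat** — one finite `T⁴` programme at fixed `ε`, Bałaban AS PRINTED; the route closes the conditional finite-𝕋⁴ rung `BalabanLadder.UV` only; NOT continuum ∕ ℝ⁴ ∕
OS ∕ mass gap ∕ Clay.  No `sorry`, no `def`, no `instance`, no `notation`.

RELATED IN THE TREE, NOT DUPLICATED: `B8Eq131Cubes.sq_le_tilde` (`□_j^{(j)} ⊆ □̃^{(j)}` WITHOUT the `±𝟙` collar — cited, the collar version is §1), `B8Eq131Cubes.cube_subset_tcube` (the
fine-lattice traces), dag-n07-w4 p627154 `levelBoxes_cubeDomains` ∕ `width_levelBox_le` (the four equations and the widths — CONSUMED as binders, not restated), FILES 6∕9 (CONSUMED).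
-/

noncomputable section

namespace Summit.QuantumFields.YangMills.BalabanUVNodes.N07DataDownTheTowerLevelBoxes

open scoped Matrix.Norms.L2Operator BigOperators
open Literature.MathematicalPhysics.QuantumFieldTheory.Balaban1983to89
open Literature.MathematicalPhysics.QuantumFieldTheory.Balaban1983to89.Node00
open T4Continuum
open T4AxialGaugeSmallField (castSite axialGauge boxPlaqs)
open B15Eq177GaugeInvariance (blockLift)
open GaugeField (gaugeAct)
open ExpMeanLog (deltaSU)
open B8Eq131Cubes (gs bLo bHi sqLo sqHi tLo tHi)
open B8Ineq130 (tlo thi tlo_apply thi_apply tlo_succ_apply thi_succ_apply)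
open Summit.QuantumFields.Balaban3D.Carriers (radialContourData)
open Summit.QuantumFields.YangMills.BalabanUVNodes.N07DataDownTheRadialTower (dist1_iter_le_down_the_radialTower_blowDown dist1_iter_le_down_the_radialRep_blowDown)
open Summit.QuantumFields.YangMills.BalabanUVNodes.N07DataDownTheTowerBlowDown (dist1_iter_rep_le_down_the_tower_blowDown)

/-! ## §1  The □̃-tower and the canonical boxes (pure `ℤ^d`) -/

section Geometry

variable {d : ℕ}

/-- The □̃-tower is an exact blow-down tower, lower corners: `□̃^{(j)}`'s corner is `L·`(`□̃^{(j+1)}`'s corner), `j < k`. [cite: Balaban1985RegularSpaces, p.98 («for every j the cube □_j is a sum of the big blocks of the lattice T_{L^{-j}}»)] -/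
theorem tildeTower_lo_step (L : ℕ) (a : Fin d → ℤ) (ρ : ℕ) {k j : ℕ} (hj : j < k) :
    tlo L (tLo a ρ) (k - j) = fun i => (L : ℤ) * tlo L (tLo a ρ) (k - (j + 1)) i := by
  have hkj : k - j = (k - (j + 1)) + 1 := by omega
  funext i
  rw [hkj, tlo_succ_apply]

/-- The □̃-tower is an exact blow-down tower, upper corners: `thi (k−j) = L·thi (k−(j+1)) + (L − 1)`, `j < k`. [cite: Balaban1985RegularSpaces, p.98 («for every j the cube □_j is a sum of the big blocks of the lattice T_{L^{-j}}»)] -/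
theorem tildeTower_hi_step (L : ℕ) (a : Fin d → ℤ) (M ρ : ℕ) {k j : ℕ} (hj : j < k) :
    thi L (tHi a M ρ) (k - j) = fun i => (L : ℤ) * thi L (tHi a M ρ) (k - (j + 1)) i + ((L : ℤ) - 1) := by
  have hkj : k - j = (k - (j + 1)) + 1 := by omega
  funext i
  rw [hkj, thi_succ_apply]
  ring

/-- The top box `□̃^{(k)} = [a − 2ρ, a + M − 1 + 2ρ]` has width `M + 4ρ − 1` in every coordinate (`1 ≤ M`). [cite: Balaban1985RegularSpaces, p.98 («A distance of its boundary to □ is equal to 2R₁M₁»)] -/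
theorem tHi_le_tLo_add (a : Fin d → ℤ) {M : ℕ} (ρ : ℕ) (hM : 1 ≤ M) : ∀ κ, tHi a M ρ κ ≤ tLo a ρ κ + ((M + 4 * ρ - 1 : ℕ) : ℤ) := by
  intro κ
  simp only [tHi, tLo]
  rw [Nat.cast_sub (by omega : 1 ≤ M + 4 * ρ)]
  push_cast
  omega

/-- The margin inequality behind «`□̃ ⊃ □_j`» WITH a one-site collar: `ρ·gs L n + 1 ≤ 2ρLⁿ` (`2 ≤ L`, `1 ≤ ρ`; [6] p. 98 «`< (1 − L⁻¹)⁻¹R₁M₁ ≤ 2R₁M₁`»).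
[cite: Balaban1985RegularSpaces, p.98 (display before (1.128))] -/
theorem margin_succ_le_tilde {L ρ : ℕ} (hL : 2 ≤ L) (hρ : 1 ≤ ρ) (n : ℕ) : ρ * gs L n + 1 ≤ L ^ n * (2 * ρ) := by
  have h2 : gs L n + 1 ≤ 2 * L ^ n := B8Ineq132.geom_margin hL n
  calc ρ * gs L n + 1 ≤ ρ * gs L n + ρ := by omega
    _ = ρ * (gs L n + 1) := by ring
    _ ≤ ρ * (2 * L ^ n) := Nat.mul_le_mul_left _ h2
    _ = L ^ n * (2 * ρ) := by ring

/-- ★ **`[□_j^{(j)} − 𝟙, □_j^{(j)} + 𝟙] ⊆ □̃^{(j)}` COMPONENTWISE**: `tlo L (tLo a ρ) (k−j) ≤ sqLo_j − 𝟙` and `sqHi_j + 𝟙 ≤ thi L (tHi a M ρ) (k−j)` (`2 ≤ L`, `1 ≤ ρ`, every `j`).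
[cite: Balaban1985RegularSpaces, p.98 («□̃ … A distance of its boundary to □ is equal to 2R₁M₁»), (1.131)–(1.133) p.99] -/
theorem levelBox_bounds {L : ℕ} (hL : 2 ≤ L) (a : Fin d → ℤ) (M : ℕ) {ρ : ℕ} (hρ : 1 ≤ ρ) (k j : ℕ) (i : Fin d) :
    tlo L (tLo a ρ) (k - j) i ≤ sqLo L a ρ k j i - 1 ∧ sqHi L a M ρ k j i + 1 ≤ thi L (tHi a M ρ) (k - j) i := by
  have hz : (ρ : ℤ) * (gs L (k - j) : ℤ) + 1 ≤ (L : ℤ) ^ (k - j) * (2 * (ρ : ℤ)) := by exact_mod_cast margin_succ_le_tilde hL hρ (k - j)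
  rw [tlo_apply, thi_apply]
  simp only [tLo, tHi, sqLo, sqHi, bLo, bHi]
  push_cast
  constructor <;> nlinarith [hz]

/-- ★ **`[□_j^{(j)} − 𝟙, □_j^{(j)} + 𝟙] ⊆ □̃^{(j)}`** as boxes of `ℤ^d` (`2 ≤ L`, `1 ≤ ρ`, every `j`; the canonical level-`j` box of dag-n07-w4 p627154, `j ≥ 1`).
[cite: Balaban1985RegularSpaces, p.98 («□̃ ⊃ □_k ⊃ … ⊃ □₀» with the 2R₁M₁ collar), (1.131) p.99] -/
theorem levelBox_subset_tildeTower {L : ℕ} (hL : 2 ≤ L) (a : Fin d → ℤ) (M : ℕ) {ρ : ℕ} (hρ : 1 ≤ ρ) (k j : ℕ) :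
    Set.Icc (sqLo L a ρ k j - 1) (sqHi L a M ρ k j + 1) ⊆ Set.Icc (tlo L (tLo a ρ) (k - j)) (thi L (tHi a M ρ) (k - j)) := by
  intro x hx
  rw [Set.mem_Icc] at hx ⊢
  refine ⟨fun i => ?_, fun i => ?_⟩
  · have h1 := hx.1 i
    simp only [Pi.sub_apply, Pi.one_apply] at h1
    exact (levelBox_bounds hL a M hρ k j i).1.trans h1
  · have h2 := hx.2 i
    simp only [Pi.add_apply, Pi.one_apply] at h2
    exact h2.trans (levelBox_bounds hL a M hρ k j i).2

/-- ★ **THE LEVEL-0 CANONICAL BOX ⊆ `□̃`** (fine lattice): the blow-down `[L(sqLo_1 − 𝟙), L(sqHi_1 + 𝟙) + (L−1)𝟙]` of the level-1 box lies in `□̃^{(0)} = [tlo L (tLo a ρ) k, thi L (tHi a M ρ) k]` (`1 ≤ k`).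
[cite: Balaban1985RegularSpaces, p.98 («□̃ ⊃ … ⊃ □₀»), (1.131) p.99] -/
theorem levelBox_zero_subset_tildeTower {L : ℕ} (hL : 2 ≤ L) (a : Fin d → ℤ) (M : ℕ) {ρ : ℕ} (hρ : 1 ≤ ρ) {k : ℕ} (hk : 1 ≤ k) :
    Set.Icc (fun i => (L : ℤ) * (sqLo L a ρ k 1 i - 1)) (fun i => (L : ℤ) * (sqHi L a M ρ k 1 i + 1) + ((L : ℤ) - 1)) ⊆
      Set.Icc (tlo L (tLo a ρ) k) (thi L (tHi a M ρ) k) := by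
  obtain ⟨k', rfl⟩ : ∃ k', k = k' + 1 := ⟨k - 1, by omega⟩
  have hL0 : (0 : ℤ) ≤ (L : ℤ) := by positivity
  intro x hx
  rw [Set.mem_Icc] at hx ⊢
  refine ⟨fun i => ?_, fun i => ?_⟩
  · have h1 := hx.1 i
    have hb := (levelBox_bounds hL a M hρ (k' + 1) 1 i).1
    rw [show k' + 1 - 1 = k' by omega] at hb
    rw [tlo_succ_apply]
    simp only at h1
    nlinarith [hb, h1, hL0]
  · have h2 := hx.2 i
    have hb := (levelBox_bounds hL a M hρ (k' + 1) 1 i).2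
    rw [show k' + 1 - 1 = k' by omega] at hb
    rw [thi_succ_apply]
    simp only at h2
    nlinarith [hb, h2, hL0]

/-- **THE FOUR EQUATIONS ARE INHABITED** (A6 non-vacuity of the binders `hlo0 hhi0 hloj hhij` of dag-n07-w4 p627154 ∕ the S6 head's `HCHART`). [folklore] -/
theorem exists_levelBoxes (L : ℕ) (a : Fin d → ℤ) (M ρ k : ℕ) :
    ∃ lo hi : ℕ → Fin d → ℤ,
      (lo 0 = fun i => (L : ℤ) * (sqLo L a ρ k 1 i - 1)) ∧ (hi 0 = fun i => (L : ℤ) * (sqHi L a M ρ k 1 i + 1) + ((L : ℤ) - 1)) ∧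
      (∀ j, 1 ≤ j → lo j = sqLo L a ρ k j - 1) ∧ (∀ j, 1 ≤ j → hi j = sqHi L a M ρ k j + 1) := by
  refine ⟨fun j => if j = 0 then (fun i => (L : ℤ) * (sqLo L a ρ k 1 i - 1)) else sqLo L a ρ k j - 1,
    fun j => if j = 0 then (fun i => (L : ℤ) * (sqHi L a M ρ k 1 i + 1) + ((L : ℤ) - 1)) else sqHi L a M ρ k j + 1, by simp, by simp,
    fun j hj => by simp [Nat.one_le_iff_ne_zero.mp hj], fun j hj => by simp [Nat.one_le_iff_ne_zero.mp hj]⟩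

end Geometry

/-! ### The torus images: all levels at once -/

section Torus

variable {P : Params}

/-- ★★ **EVERY CANONICAL LEVEL BOX LIES IN THE □̃-TOWER BOX OF ITS LEVEL** under the torus projection: from p627154's four equations, `castSite '' [lo j, hi j] ⊆ castSite '' □̃^{(j)}` for every
`j` (`1 ≤ k`, `1 ≤ ρ`; `2 ≤ L` is the lattice's). [cite: Balaban1985RegularSpaces, p.98 («□̃ ⊃ □_k ⊃ … ⊃ □₀»), (1.131) p.99; Balaban1985Variational, (145) p.301 («on □̃»)] -/
theorem castSite_levelBoxes_subset_tildeTower (a : Fin P.d → ℤ) (M : ℕ) {ρ : ℕ} (hρ : 1 ≤ ρ) {k : ℕ} (hk : 1 ≤ k) {lo hi : ℕ → Fin P.d → ℤ}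
    (hlo0 : lo 0 = fun i => (P.L : ℤ) * (sqLo P.L a ρ k 1 i - 1)) (hhi0 : hi 0 = fun i => (P.L : ℤ) * (sqHi P.L a M ρ k 1 i + 1) + ((P.L : ℤ) - 1))
    (hloj : ∀ j, 1 ≤ j → lo j = sqLo P.L a ρ k j - 1) (hhij : ∀ j, 1 ≤ j → hi j = sqHi P.L a M ρ k j + 1) (j : ℕ) :
    (castSite '' Set.Icc (lo j) (hi j) : Set (Site P j)) ⊆ castSite '' Set.Icc (tlo P.L (tLo a ρ) (k - j)) (thi P.L (tHi a M ρ) (k - j)) := by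
  have hL : 2 ≤ P.L := by have := P.hL.2; omega
  refine Set.image_mono ?_
  rcases Nat.eq_zero_or_pos j with rfl | hj
  · rw [hlo0, hhi0, Nat.sub_zero]
    exact levelBox_zero_subset_tildeTower hL a M hρ hk
  · rw [hloj j hj, hhij j hj]
    exact levelBox_subset_tildeTower hL a M hρ k j

end Torus

/-! ## §2  (145)∕(151) down the □̃-tower, read on the canonical boxes -/

section Down

variable {F : T4Continuum.T4Family} {N : ℕ} [NeZero N] {K : ℕ}

/-- ★★★ **(151) DOWN THE RADIAL TOWER OF `□̃`, READ ON THE CANONICAL BOXES** (top letter DISPLAYED): FILE 9's `dist1_iter_le_down_the_radialTower_blowDown` on the □̃-tower `[tlo L (tLo a ρ) (k−j),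
thi L (tHi a M ρ) (k−j)]` of a representative `U′` whose averages carry the radial axial gauge below `k`, restricted to p627154's canonical boxes `lo hi` (four equations): every level-`j` bond of the
canonical box obeys `dist1 (M^j U′ c) ≤ v_j` — displayed: the per-level plaquette letters `a_j` of `M^j U′` on the □̃-tower boxes (both shapes of FILE 9), the top letter `v_k` on `□̃^{(k)}`, the ladder.
[cite: Balaban1985Variational, (145)–(146) p.301, (151) p.301; Balaban1985RegularSpaces, p.98, Lemma 1 (1.25) p.79, (1.15) p.78] -/
theorem dist1_iter_le_down_the_radialTower_levelBoxes {k : ℕ} (hk1 : 1 ≤ k) (hk : k ≤ (F.P K).m + (F.P K).K) (U' : GaugeField (F.P K) 0 (SU N))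
    (hax : ∀ i < k, AxialGauge (radialContourData (F.P K) i (SU N)) (Averaging.iter (avOfRecord F N K) i U'))
    (a₀ : Fin (F.P K).d → ℤ) (M : ℕ) {ρ : ℕ} (hρ : 1 ≤ ρ)
    {lo hi : ℕ → Fin (F.P K).d → ℤ}
    (hlo0 : lo 0 = fun i => ((F.P K).L : ℤ) * (sqLo (F.P K).L a₀ ρ k 1 i - 1))
    (hhi0 : hi 0 = fun i => ((F.P K).L : ℤ) * (sqHi (F.P K).L a₀ M ρ k 1 i + 1) + (((F.P K).L : ℤ) - 1))
    (hloj : ∀ j, 1 ≤ j → lo j = sqLo (F.P K).L a₀ ρ k j - 1) (hhij : ∀ j, 1 ≤ j → hi j = sqHi (F.P K).L a₀ M ρ k j + 1)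
    (a v : ℕ → ℝ) (ha : ∀ j < k, 0 ≤ a j)
    (ht : ∀ j < k, (((((F.P K).d + 2) * (F.P K).L : ℕ) : ℝ) ^ 2 / 4) * a j < deltaSU (Fin N))
    (hplaq : ∀ j < k, ∀ c : PBond (F.P K) (j + 1),
      c.src ∈ (castSite '' Set.Icc (tlo (F.P K).L (tLo a₀ ρ) (k - (j + 1))) (thi (F.P K).L (tHi a₀ M ρ) (k - (j + 1))) : Set (Site (F.P K) (j + 1))) →
      c.tgt ∈ (castSite '' Set.Icc (tlo (F.P K).L (tLo a₀ ρ) (k - (j + 1))) (thi (F.P K).L (tHi a₀ M ρ) (k - (j + 1))) : Set (Site (F.P K) (j + 1))) →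
      ∀ q : Plaq (F.P K) j, (blockOf q.src = c.src.unshift c.dir ∨ blockOf q.src = c.src ∨ blockOf q.src = c.tgt) →
      dist1 (GaugeField.plaqHol (Averaging.iter (avOfRecord F N K) j U') q) < a j)
    (hplaqB : ∀ j < k, ∀ y : Site (F.P K) (j + 1),
      y ∈ (castSite '' Set.Icc (tlo (F.P K).L (tLo a₀ ρ) (k - (j + 1))) (thi (F.P K).L (tHi a₀ M ρ) (k - (j + 1))) : Set (Site (F.P K) (j + 1))) →
      ∀ q : Plaq (F.P K) j, blockOf q.src = y → dist1 (GaugeField.plaqHol (Averaging.iter (avOfRecord F N K) j U') q) < a j)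
    (htop : ∀ c : PBond (F.P K) k, c.src ∈ (castSite '' Set.Icc (tLo a₀ ρ) (tHi a₀ M ρ) : Set (Site (F.P K) k)) → c.tgt ∈ (castSite '' Set.Icc (tLo a₀ ρ) (tHi a₀ M ρ) : Set (Site (F.P K) k)) →
      dist1 (Averaging.iter (avOfRecord F N K) k U' c) ≤ v k)
    (hv : ∀ j < k, max (((((F.P K).d * ((F.P K).L - 1) + 1 : ℕ) : ℝ) * (((((F.P K).d - 1 : ℕ) : ℝ) * (((F.P K).L - 1 : ℕ) : ℝ)) * a j)))
      (v (j + 1) + 7 * ((((((F.P K).d + 2) * (F.P K).L : ℕ) : ℝ) ^ 2 / 4) * a j) +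
        ((((F.P K).d + 1) * ((F.P K).L - 1) : ℕ) : ℝ) * ((((F.P K).d * ((F.P K).L - 1) + 1 : ℕ) : ℝ) * (((((F.P K).d - 1 : ℕ) : ℝ) * (((F.P K).L - 1 : ℕ) : ℝ)) * a j))) ≤ v j) :
    ∀ j ≤ k, ∀ c : PBond (F.P K) j, c.src ∈ (castSite '' Set.Icc (lo j) (hi j) : Set (Site (F.P K) j)) → c.tgt ∈ (castSite '' Set.Icc (lo j) (hi j) : Set (Site (F.P K) j)) →
      dist1 (Averaging.iter (avOfRecord F N K) j U' c) ≤ v j := by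
  have key := dist1_iter_le_down_the_radialTower_blowDown hk U' hax (fun j => tlo (F.P K).L (tLo a₀ ρ) (k - j)) (fun j => thi (F.P K).L (tHi a₀ M ρ) (k - j))
    (fun j hj => tildeTower_lo_step (F.P K).L a₀ ρ hj) (fun j hj => tildeTower_hi_step (F.P K).L a₀ M ρ hj) a v ha ht hplaq hplaqB
    (by simpa only [Nat.sub_self, B8Ineq130.tlo_zero, B8Ineq130.thi_zero] using htop) hv
  intro j hj c hs htg
  have hsub := castSite_levelBoxes_subset_tildeTower (P := F.P K) a₀ M hρ hk1 hlo0 hhi0 hloj hhij j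
  exact key j hj c (hsub hs) (hsub htg)

/-- ★★★★ **(151) DOWN THE RADIAL TOWER OF `□̃` AT THE (147) REPRESENTATIVE `U″ := U′^{h̄}`, READ ON THE CANONICAL BOXES, TOP LETTER SUPPLIED** — the data-lane half of the S6 head's `HCHART`
`v`-clause shape: `U′` carries the radial tower below `k ≤ m + K`; `h := axialGauge (M^k U′) (tLo a ρ) (tHi a M ρ)` is the top axial gauge on `□̃^{(k)}` (non-wrapping `M + 4ρ < sitesPerDir k`,
`1 ≤ M`); the plaquettes of `M^k U′` based in `□̃^{(k)}` are `< δ`.  Then for p627154's canonical boxes `lo hi` (four equations) and every `j ≤ k`, every level-`j` bond `c` of the canonical box obeys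
`dist1 (M^j U″ c) ≤ v_j` for any ladder from `v_k ≥ (d−1)(M+4ρ−1)δ` — displayed: the per-level plaquette letters of `M^j U″` on the □̃-tower boxes (both shapes; gauge-invariant, FILE 6
`dist1_plaqHol_iter_gaugeAct`), the ladder.  FILE 9's `dist1_iter_le_down_the_radialRep_blowDown` on the □̃-tower ∘ §1.
[cite: Balaban1985Variational, (144) p.300, (145)–(147) p.301, (151) p.301; Balaban1985RegularSpaces, p.98, (1.15) p.78, Lemma 1 (1.25) p.79] -/
theorem dist1_iter_le_down_the_radialRep_levelBoxes {k : ℕ} (hk1 : 1 ≤ k) (hk : k ≤ (F.P K).m + (F.P K).K) (U' : GaugeField (F.P K) 0 (SU N))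
    (hax : ∀ i < k, AxialGauge (radialContourData (F.P K) i (SU N)) (Averaging.iter (avOfRecord F N K) i U'))
    (a₀ : Fin (F.P K).d → ℤ) {M ρ : ℕ} (hM : 1 ≤ M) (hρ : 1 ≤ ρ) (hwrap : M + 4 * ρ < (F.P K).sitesPerDir k)
    {lo hi : ℕ → Fin (F.P K).d → ℤ}
    (hlo0 : lo 0 = fun i => ((F.P K).L : ℤ) * (sqLo (F.P K).L a₀ ρ k 1 i - 1))
    (hhi0 : hi 0 = fun i => ((F.P K).L : ℤ) * (sqHi (F.P K).L a₀ M ρ k 1 i + 1) + (((F.P K).L : ℤ) - 1))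
    (hloj : ∀ j, 1 ≤ j → lo j = sqLo (F.P K).L a₀ ρ k j - 1) (hhij : ∀ j, 1 ≤ j → hi j = sqHi (F.P K).L a₀ M ρ k j + 1)
    {δ : ℝ} {S₀ : Set (Plaq (F.P K) k)} (hS₀ : boxPlaqs (tLo a₀ ρ) (tHi a₀ M ρ) ⊆ S₀) (hV : PlaqSmallOn S₀ δ (Averaging.iter (avOfRecord F N K) k U')) (hδ : 0 ≤ δ)
    (a v : ℕ → ℝ) (ha : ∀ j < k, 0 ≤ a j)
    (ht : ∀ j < k, (((((F.P K).d + 2) * (F.P K).L : ℕ) : ℝ) ^ 2 / 4) * a j < deltaSU (Fin N))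
    (hplaq : ∀ j < k, ∀ c : PBond (F.P K) (j + 1),
      c.src ∈ (castSite '' Set.Icc (tlo (F.P K).L (tLo a₀ ρ) (k - (j + 1))) (thi (F.P K).L (tHi a₀ M ρ) (k - (j + 1))) : Set (Site (F.P K) (j + 1))) →
      c.tgt ∈ (castSite '' Set.Icc (tlo (F.P K).L (tLo a₀ ρ) (k - (j + 1))) (thi (F.P K).L (tHi a₀ M ρ) (k - (j + 1))) : Set (Site (F.P K) (j + 1))) →
      ∀ q : Plaq (F.P K) j, (blockOf q.src = c.src.unshift c.dir ∨ blockOf q.src = c.src ∨ blockOf q.src = c.tgt) →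
      dist1 (GaugeField.plaqHol (Averaging.iter (avOfRecord F N K) j
        (gaugeAct (blockLift k (axialGauge (Averaging.iter (avOfRecord F N K) k U') (tLo a₀ ρ) (tHi a₀ M ρ))) U')) q) < a j)
    (hplaqB : ∀ j < k, ∀ y : Site (F.P K) (j + 1),
      y ∈ (castSite '' Set.Icc (tlo (F.P K).L (tLo a₀ ρ) (k - (j + 1))) (thi (F.P K).L (tHi a₀ M ρ) (k - (j + 1))) : Set (Site (F.P K) (j + 1))) →
      ∀ q : Plaq (F.P K) j, blockOf q.src = y →
      dist1 (GaugeField.plaqHol (Averaging.iter (avOfRecord F N K) j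
        (gaugeAct (blockLift k (axialGauge (Averaging.iter (avOfRecord F N K) k U') (tLo a₀ ρ) (tHi a₀ M ρ))) U')) q) < a j)
    (hvk : (((F.P K).d - 1 : ℕ) : ℝ) * ((M + 4 * ρ - 1 : ℕ) : ℝ) * δ ≤ v k)
    (hv : ∀ j < k, max (((((F.P K).d * ((F.P K).L - 1) + 1 : ℕ) : ℝ) * (((((F.P K).d - 1 : ℕ) : ℝ) * (((F.P K).L - 1 : ℕ) : ℝ)) * a j)))
      (v (j + 1) + 7 * ((((((F.P K).d + 2) * (F.P K).L : ℕ) : ℝ) ^ 2 / 4) * a j) +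
        ((((F.P K).d + 1) * ((F.P K).L - 1) : ℕ) : ℝ) * ((((F.P K).d * ((F.P K).L - 1) + 1 : ℕ) : ℝ) * (((((F.P K).d - 1 : ℕ) : ℝ) * (((F.P K).L - 1 : ℕ) : ℝ)) * a j))) ≤ v j) :
    ∀ j ≤ k, ∀ c : PBond (F.P K) j, c.src ∈ (castSite '' Set.Icc (lo j) (hi j) : Set (Site (F.P K) j)) → c.tgt ∈ (castSite '' Set.Icc (lo j) (hi j) : Set (Site (F.P K) j)) →
      dist1 (Averaging.iter (avOfRecord F N K) j (gaugeAct (blockLift k (axialGauge (Averaging.iter (avOfRecord F N K) k U') (tLo a₀ ρ) (tHi a₀ M ρ))) U') c) ≤ v j := by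
  have hn : ∀ κ, (fun j => thi (F.P K).L (tHi a₀ M ρ) (k - j)) k κ ≤ (fun j => tlo (F.P K).L (tLo a₀ ρ) (k - j)) k κ + ((M + 4 * ρ - 1 : ℕ) : ℤ) := by
    simpa only [Nat.sub_self, B8Ineq130.tlo_zero, B8Ineq130.thi_zero] using tHi_le_tLo_add a₀ ρ hM
  have hnN : (M + 4 * ρ - 1) + 1 < (F.P K).sitesPerDir k := by omega
  have key := dist1_iter_le_down_the_radialRep_blowDown hk U' hax (fun j => tlo (F.P K).L (tLo a₀ ρ) (k - j)) (fun j => thi (F.P K).L (tHi a₀ M ρ) (k - j))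
    (fun j hj => tildeTower_lo_step (F.P K).L a₀ ρ hj) (fun j hj => tildeTower_hi_step (F.P K).L a₀ M ρ hj) hn hnN
    (by simpa only [Nat.sub_self, B8Ineq130.tlo_zero, B8Ineq130.thi_zero] using hS₀) hV hδ a v ha ht
    (by simpa only [Nat.sub_self, B8Ineq130.tlo_zero, B8Ineq130.thi_zero] using hplaq)
    (by simpa only [Nat.sub_self, B8Ineq130.tlo_zero, B8Ineq130.thi_zero] using hplaqB) hvk hv
  simp only [Nat.sub_self, B8Ineq130.tlo_zero, B8Ineq130.thi_zero] at key
  intro j hj c hs htg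
  have hsub := castSite_levelBoxes_subset_tildeTower (P := F.P K) a₀ M hρ hk1 hlo0 hhi0 hloj hhij j
  exact key j hj c (hsub hs) (hsub htg)

/-- ★★ **(151) DOWN A GENERIC TOWER OF `□̃` AT THE REPRESENTATIVE `U′^{h̄}`, READ ON THE CANONICAL BOXES** (road (T): within-block letters `τ_j` and the binder `hint` DISPLAYED): FILE 6's
`dist1_iter_rep_le_down_the_tower_blowDown` on the □̃-tower, restricted to p627154's canonical boxes; top letter `(d−1)(M+4ρ−1)δ` from module 40.
[cite: Balaban1985Variational, (145)–(147) p.301, (151) p.301, (155) p.302; Balaban1985RegularSpaces, p.98, Lemma 1 (1.25) p.79] -/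
theorem dist1_iter_rep_le_down_the_tower_levelBoxes {k : ℕ} (hk1 : 1 ≤ k) (hk : k ≤ (F.P K).m + (F.P K).K) (U' : GaugeField (F.P K) 0 (SU N))
    (a₀ : Fin (F.P K).d → ℤ) {M ρ : ℕ} (hM : 1 ≤ M) (hρ : 1 ≤ ρ) (hwrap : M + 4 * ρ < (F.P K).sitesPerDir k)
    {lo hi : ℕ → Fin (F.P K).d → ℤ}
    (hlo0 : lo 0 = fun i => ((F.P K).L : ℤ) * (sqLo (F.P K).L a₀ ρ k 1 i - 1))
    (hhi0 : hi 0 = fun i => ((F.P K).L : ℤ) * (sqHi (F.P K).L a₀ M ρ k 1 i + 1) + (((F.P K).L : ℤ) - 1))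
    (hloj : ∀ j, 1 ≤ j → lo j = sqLo (F.P K).L a₀ ρ k j - 1) (hhij : ∀ j, 1 ≤ j → hi j = sqHi (F.P K).L a₀ M ρ k j + 1)
    {δ : ℝ} {S₀ : Set (Plaq (F.P K) k)} (hS₀ : boxPlaqs (tLo a₀ ρ) (tHi a₀ M ρ) ⊆ S₀) (hV : PlaqSmallOn S₀ δ (Averaging.iter (avOfRecord F N K) k U')) (hδ : 0 ≤ δ)
    (a τ v : ℕ → ℝ) (ha : ∀ j < k, 0 ≤ a j) (hτ : ∀ j < k, 0 ≤ τ j)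
    (ht : ∀ j < k, (((((F.P K).d + 2) * (F.P K).L : ℕ) : ℝ) ^ 2 / 4) * a j < deltaSU (Fin N))
    (hplaq : ∀ j < k, ∀ c : PBond (F.P K) (j + 1),
      c.src ∈ (castSite '' Set.Icc (tlo (F.P K).L (tLo a₀ ρ) (k - (j + 1))) (thi (F.P K).L (tHi a₀ M ρ) (k - (j + 1))) : Set (Site (F.P K) (j + 1))) →
      c.tgt ∈ (castSite '' Set.Icc (tlo (F.P K).L (tLo a₀ ρ) (k - (j + 1))) (thi (F.P K).L (tHi a₀ M ρ) (k - (j + 1))) : Set (Site (F.P K) (j + 1))) →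
      ∀ q : Plaq (F.P K) j, (blockOf q.src = c.src.unshift c.dir ∨ blockOf q.src = c.src ∨ blockOf q.src = c.tgt) →
      dist1 (GaugeField.plaqHol (Averaging.iter (avOfRecord F N K) j
        (gaugeAct (blockLift k (axialGauge (Averaging.iter (avOfRecord F N K) k U') (tLo a₀ ρ) (tHi a₀ M ρ))) U')) q) < a j)
    (hint : ∀ j < k, ∀ b : PBond (F.P K) j, blockOf b.src = blockOf b.tgt →
      blockOf b.src ∈ (castSite '' Set.Icc (tlo (F.P K).L (tLo a₀ ρ) (k - (j + 1))) (thi (F.P K).L (tHi a₀ M ρ) (k - (j + 1))) : Set (Site (F.P K) (j + 1))) →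
      dist1 (Averaging.iter (avOfRecord F N K) j (gaugeAct (blockLift k (axialGauge (Averaging.iter (avOfRecord F N K) k U') (tLo a₀ ρ) (tHi a₀ M ρ))) U') b) ≤ τ j)
    (hvk : (((F.P K).d - 1 : ℕ) : ℝ) * ((M + 4 * ρ - 1 : ℕ) : ℝ) * δ ≤ v k)
    (hv : ∀ j < k, max (τ j) (v (j + 1) + 7 * ((((((F.P K).d + 2) * (F.P K).L : ℕ) : ℝ) ^ 2 / 4) * a j) + ((((F.P K).d + 1) * ((F.P K).L - 1) : ℕ) : ℝ) * τ j) ≤ v j) :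
    ∀ j ≤ k, ∀ c : PBond (F.P K) j, c.src ∈ (castSite '' Set.Icc (lo j) (hi j) : Set (Site (F.P K) j)) → c.tgt ∈ (castSite '' Set.Icc (lo j) (hi j) : Set (Site (F.P K) j)) →
      dist1 (Averaging.iter (avOfRecord F N K) j (gaugeAct (blockLift k (axialGauge (Averaging.iter (avOfRecord F N K) k U') (tLo a₀ ρ) (tHi a₀ M ρ))) U') c) ≤ v j := by
  have hn : ∀ κ, (fun j => thi (F.P K).L (tHi a₀ M ρ) (k - j)) k κ ≤ (fun j => tlo (F.P K).L (tLo a₀ ρ) (k - j)) k κ + ((M + 4 * ρ - 1 : ℕ) : ℤ) := by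
    simpa only [Nat.sub_self, B8Ineq130.tlo_zero, B8Ineq130.thi_zero] using tHi_le_tLo_add a₀ ρ hM
  have hnN : (M + 4 * ρ - 1) + 1 < (F.P K).sitesPerDir k := by omega
  have key := dist1_iter_rep_le_down_the_tower_blowDown hk U' (fun j => tlo (F.P K).L (tLo a₀ ρ) (k - j)) (fun j => thi (F.P K).L (tHi a₀ M ρ) (k - j))
    (fun j hj => tildeTower_lo_step (F.P K).L a₀ ρ hj) (fun j hj => tildeTower_hi_step (F.P K).L a₀ M ρ hj) hn hnN
    (by simpa only [Nat.sub_self, B8Ineq130.tlo_zero, B8Ineq130.thi_zero] using hS₀) hV hδ a τ v ha hτ ht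
    (by simpa only [Nat.sub_self, B8Ineq130.tlo_zero, B8Ineq130.thi_zero] using hplaq)
    (by simpa only [Nat.sub_self, B8Ineq130.tlo_zero, B8Ineq130.thi_zero] using hint) hvk hv
  simp only [Nat.sub_self, B8Ineq130.tlo_zero, B8Ineq130.thi_zero] at key
  intro j hj c hs htg
  have hsub := castSite_levelBoxes_subset_tildeTower (P := F.P K) a₀ M hρ hk1 hlo0 hhi0 hloj hhij j
  exact key j hj c (hsub hs) (hsub htg)

/-! ## §3  An explicit affine ladder (the head's «affine in the letters, uniform in the datum» shape) -/

/-- **AN EXPLICIT LADDER**: with `C′ := 7Q + (E + 1)·(A·BC)` and `v_j := T + C′·Σ_{i ∈ [j,k)} a_i` (`T, A, BC, Q, E, a_i ≥ 0`) the ladder inequalities of FILES 5∕6∕9 hold: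
`T ≤ v_k` and `max (A·(BC·a_j)) (v_{j+1} + 7(Q·a_j) + E·(A·(BC·a_j))) ≤ v_j` for `j < k` — elementary real arithmetic (the letters enter `v_j` AFFINELY).
[cite: Balaban1985Variational, (146) p.301, (151) p.301 (the shape «9dL²Mε₀»: linear in the letters)] -/
theorem ladder_of_sum {k : ℕ} (a : ℕ → ℝ) (ha : ∀ j < k, 0 ≤ a j) {T A BC Q E : ℝ} (hT : 0 ≤ T) (hA : 0 ≤ A) (hBC : 0 ≤ BC) (hQ : 0 ≤ Q) (hE : 0 ≤ E) :
    (T ≤ T + (7 * Q + (E + 1) * (A * BC)) * ∑ i ∈ Finset.Ico k k, a i) ∧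
    ∀ j < k, max (A * (BC * a j)) ((T + (7 * Q + (E + 1) * (A * BC)) * ∑ i ∈ Finset.Ico (j + 1) k, a i) + 7 * (Q * a j) + E * (A * (BC * a j)))
      ≤ T + (7 * Q + (E + 1) * (A * BC)) * ∑ i ∈ Finset.Ico j k, a i := by
  refine ⟨by simp, fun j hj => ?_⟩
  rw [Finset.sum_eq_sum_Ico_succ_bot hj]
  set S := ∑ i ∈ Finset.Ico (j + 1) k, a i with hS_def
  have hS : 0 ≤ S := Finset.sum_nonneg fun i hi => ha i (Finset.mem_Ico.mp hi).2
  have haj : 0 ≤ a j := ha j hj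
  have h1 : 0 ≤ Q * a j := mul_nonneg hQ haj
  have h2 : 0 ≤ A * (BC * a j) := mul_nonneg hA (mul_nonneg hBC haj)
  have h3 : 0 ≤ E * (A * (BC * a j)) := mul_nonneg hE h2
  have h4 : 0 ≤ (7 * Q + (E + 1) * (A * BC)) * S := mul_nonneg (by positivity) hS
  refine max_le ?_ ?_ <;> nlinarith [h1, h2, h3, h4, hT]

/-- ★★★ **THE CANONICAL-BOX `v`-CLAUSE WITH AN EXPLICIT AFFINE LADDER** (the S6 head's «letters affine per level, uniform in the datum», dag-n07-w4 g4 CLAIM-8): §2's ★★★★ `dist1_iter_le_down_the_radialRep_levelBoxes`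
with the ladder `v_j := (d−1)(M+4ρ−1)·δ + C′·Σ_{i∈[j,k)} a_i`, `C′ := 7·((d+2)L)²∕4 + ((d+1)(L−1) + 1)·(d(L−1)+1)(d−1)(L−1)` SUPPLIED by `ladder_of_sum` — only the per-level (7)-letters `a_i` of `M^i U″` on the □̃-tower
and the top letter `δ` on `□̃^{(k)}` remain displayed. [cite: Balaban1985Variational, (145)–(147) p.301, (151) p.301; Balaban1985RegularSpaces, p.98, Lemma 1 (1.25) p.79] -/
theorem dist1_iter_le_down_the_radialRep_levelBoxes_explicit {k : ℕ} (hk1 : 1 ≤ k) (hk : k ≤ (F.P K).m + (F.P K).K) (U' : GaugeField (F.P K) 0 (SU N))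
    (hax : ∀ i < k, AxialGauge (radialContourData (F.P K) i (SU N)) (Averaging.iter (avOfRecord F N K) i U'))
    (a₀ : Fin (F.P K).d → ℤ) {M ρ : ℕ} (hM : 1 ≤ M) (hρ : 1 ≤ ρ) (hwrap : M + 4 * ρ < (F.P K).sitesPerDir k)
    {lo hi : ℕ → Fin (F.P K).d → ℤ}
    (hlo0 : lo 0 = fun i => ((F.P K).L : ℤ) * (sqLo (F.P K).L a₀ ρ k 1 i - 1))
    (hhi0 : hi 0 = fun i => ((F.P K).L : ℤ) * (sqHi (F.P K).L a₀ M ρ k 1 i + 1) + (((F.P K).L : ℤ) - 1))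
    (hloj : ∀ j, 1 ≤ j → lo j = sqLo (F.P K).L a₀ ρ k j - 1) (hhij : ∀ j, 1 ≤ j → hi j = sqHi (F.P K).L a₀ M ρ k j + 1)
    {δ : ℝ} {S₀ : Set (Plaq (F.P K) k)} (hS₀ : boxPlaqs (tLo a₀ ρ) (tHi a₀ M ρ) ⊆ S₀) (hV : PlaqSmallOn S₀ δ (Averaging.iter (avOfRecord F N K) k U')) (hδ : 0 ≤ δ)
    (a : ℕ → ℝ) (ha : ∀ j < k, 0 ≤ a j)
    (ht : ∀ j < k, (((((F.P K).d + 2) * (F.P K).L : ℕ) : ℝ) ^ 2 / 4) * a j < deltaSU (Fin N))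
    (hplaq : ∀ j < k, ∀ c : PBond (F.P K) (j + 1),
      c.src ∈ (castSite '' Set.Icc (tlo (F.P K).L (tLo a₀ ρ) (k - (j + 1))) (thi (F.P K).L (tHi a₀ M ρ) (k - (j + 1))) : Set (Site (F.P K) (j + 1))) →
      c.tgt ∈ (castSite '' Set.Icc (tlo (F.P K).L (tLo a₀ ρ) (k - (j + 1))) (thi (F.P K).L (tHi a₀ M ρ) (k - (j + 1))) : Set (Site (F.P K) (j + 1))) →
      ∀ q : Plaq (F.P K) j, (blockOf q.src = c.src.unshift c.dir ∨ blockOf q.src = c.src ∨ blockOf q.src = c.tgt) →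
      dist1 (GaugeField.plaqHol (Averaging.iter (avOfRecord F N K) j
        (gaugeAct (blockLift k (axialGauge (Averaging.iter (avOfRecord F N K) k U') (tLo a₀ ρ) (tHi a₀ M ρ))) U')) q) < a j)
    (hplaqB : ∀ j < k, ∀ y : Site (F.P K) (j + 1),
      y ∈ (castSite '' Set.Icc (tlo (F.P K).L (tLo a₀ ρ) (k - (j + 1))) (thi (F.P K).L (tHi a₀ M ρ) (k - (j + 1))) : Set (Site (F.P K) (j + 1))) →
      ∀ q : Plaq (F.P K) j, blockOf q.src = y →
      dist1 (GaugeField.plaqHol (Averaging.iter (avOfRecord F N K) j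
        (gaugeAct (blockLift k (axialGauge (Averaging.iter (avOfRecord F N K) k U') (tLo a₀ ρ) (tHi a₀ M ρ))) U')) q) < a j) :
    ∀ j ≤ k, ∀ c : PBond (F.P K) j, c.src ∈ (castSite '' Set.Icc (lo j) (hi j) : Set (Site (F.P K) j)) → c.tgt ∈ (castSite '' Set.Icc (lo j) (hi j) : Set (Site (F.P K) j)) →
      dist1 (Averaging.iter (avOfRecord F N K) j (gaugeAct (blockLift k (axialGauge (Averaging.iter (avOfRecord F N K) k U') (tLo a₀ ρ) (tHi a₀ M ρ))) U') c) ≤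
        (((F.P K).d - 1 : ℕ) : ℝ) * ((M + 4 * ρ - 1 : ℕ) : ℝ) * δ +
          (7 * ((((((F.P K).d + 2) * (F.P K).L : ℕ) : ℝ) ^ 2 / 4)) +
              ((((((F.P K).d + 1) * ((F.P K).L - 1) : ℕ) : ℝ)) + 1) *
                (((((F.P K).d * ((F.P K).L - 1) + 1 : ℕ) : ℝ)) * (((((F.P K).d - 1 : ℕ) : ℝ) * (((F.P K).L - 1 : ℕ) : ℝ))))) *
            ∑ i ∈ Finset.Ico j k, a i := by
  have hT : (0 : ℝ) ≤ (((F.P K).d - 1 : ℕ) : ℝ) * ((M + 4 * ρ - 1 : ℕ) : ℝ) * δ := by positivity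
  have hlad := ladder_of_sum (k := k) a ha hT
    (A := ((((F.P K).d * ((F.P K).L - 1) + 1 : ℕ) : ℝ))) (BC := (((((F.P K).d - 1 : ℕ) : ℝ) * (((F.P K).L - 1 : ℕ) : ℝ))))
    (Q := ((((((F.P K).d + 2) * (F.P K).L : ℕ) : ℝ) ^ 2 / 4))) (E := (((((F.P K).d + 1) * ((F.P K).L - 1) : ℕ) : ℝ)))
    (by positivity) (by positivity) (by positivity) (by positivity)
  exact dist1_iter_le_down_the_radialRep_levelBoxes hk1 hk U' hax a₀ hM hρ hwrap hlo0 hhi0 hloj hhij hS₀ hV hδ a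
    (fun j => (((F.P K).d - 1 : ℕ) : ℝ) * ((M + 4 * ρ - 1 : ℕ) : ℝ) * δ +
      (7 * ((((((F.P K).d + 2) * (F.P K).L : ℕ) : ℝ) ^ 2 / 4)) +
          ((((((F.P K).d + 1) * ((F.P K).L - 1) : ℕ) : ℝ)) + 1) *
            (((((F.P K).d * ((F.P K).L - 1) + 1 : ℕ) : ℝ)) * (((((F.P K).d - 1 : ℕ) : ℝ) * (((F.P K).L - 1 : ℕ) : ℝ))))) *
        ∑ i ∈ Finset.Ico j k, a i)
    ha ht hplaq hplaqB hlad.1 hlad.2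

end Down

end Summit.QuantumFields.YangMills.BalabanUVNodes.N07DataDownTheTowerLevelBoxes
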